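import Summits.BirchSwinnertonDyer.Rank1Residual.Additive.X4ThreeKuriharaCertKernelPsi3
import HarnessLib

/-!
# Full rational `3`-torsion forces the discriminant to be a cube; hence "`Δ_E` not a cube mod `ℓ`
# ⟹ `Ẽ(𝔽_ℓ)[3]` is cyclic" at every prime `ℓ ≥ 5` (cell `b2b-bsdres`, team n1011, seat p15 GEN 5,
# OWNERS row T-ICYC; one direction of r1's conjecture item I-CYC′, ROUTE-1 §39.2 (d) / §39.4 R1-68)

HONEST FRAMING (cell `b2b-bsdres`, run/shared/lean/b2b/bsd-rank1-residual/, verbatim in every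
file): the goal of the cell is to DELETE the COMBINATION-SHAPED residual classes of the
Birch–Swinnerton-Dyer formula for ALL analytic-rank `≤ 1` elliptic curves over `ℚ` — "full BSD
formula for every rank `≤ 1` curve in class `C`" assembled STRICTLY from published theorems — so
that the rank-`≤ 1` remainder becomes exactly the CONSTRUCTION-SHAPED classes, which are TYPED
(missing-input `Prop`s), NOT attempted. This is not "finishing BSD". Team n1011 (N10/N11, the
additive block `X4 ∧ p = 3`) is a RESEARCH ROUTE; no claim beyond the stated classes; the label X4 and
the mark of RESIDUAL-MAP §I N11 are UNCHANGED; nothing is booked. TOOL theorems only: elementary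
algebra of the `3`-division polynomial and of the points of a Weierstrass curve over a field; no
named fact, no definition, no `sorry`; no Galois theory, no algebraic closure, no radical formula.

## What and why

Every Kurihara-number certificate of the cell at `p = 3` carries, per prime `ℓ` of the Kolyvagin
level, the CYCLICITY binder `#Ẽ(𝔽_ℓ)[3] ≤ 3` (Kim's `𝒫_k`: `Ẽ(𝔽_ℓ)[3]` cyclic), today certified per
record by a point count (`X4ThreeKuriharaCertKernel`) or by one root of `Ψ₃ mod ℓ`
(`X4ThreeKuriharaCertKernelPsi3`).  r1 GEN 27 (ROUTE-1 §39.2 (d)) READ OFF THE DATA the law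
"for `ℓ ∈ 𝒫₁(E, 3)`: `Ẽ(𝔽_ℓ)[3]` cyclic ⟺ `Δ_E` is not a cube mod `ℓ`" (1 113/1 113 cyclic primes,
121/121 full-`3`-torsion primes) and registered it as the conjecture item I-CYC′ (§39.4 R1-68).  ONE
DIRECTION is an elementary THEOREM, proved here for every field of characteristic `∤ 6`:

* §1 `c₄_sub_nine_mul_sq_pow_three_eq` — **the resolvent identity**: if
  `Ψ₃ = 3 (X - x₁)(X - x₂)(X - x₃)(X - x₄)` in `K[X]` then
  `(c₄ - 9 (x₁ + x₂ - x₃ - x₄)²)³ = 1728 Δ` (the resolvent cubic of the quartic `Ψ₃/3` in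
  `T = (x₁ + x₂ - x₃ - x₄)²` is the shifted pure cube `(T - c₄/9)³ = -64Δ/27`; classically
  `(3(x₁ + x₂ - x₃ - x₄))² = c₄ - 12 ζ^i ∛Δ`).  Proof: Vieta (`b₂ = -3e₁`, `b₄ = e₂`, `b₆ = -e₃`,
  `b₈ = 3e₄`), `c₄ - 9θ = 12(e₂ - 3w)` with `w = x₁x₂ + x₃x₄`, and
  `(e₂ - 3w)³ - Δ = 9·(12e₄ - 3e₁e₃ + e₂²)·(e₂ - w) - 27·R(w)` where
  `R(w) = w³ - e₂w² + (e₁e₃ - 4e₄)w - (e₁²e₄ - 4e₂e₄ + e₃²)` vanishes identically and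
  `12e₄ - 3e₁e₃ + e₂² = 0` is Mathlib's `b_relation` (`4b₈ = b₂b₆ - b₄²`) in Vieta coordinates —
  ONE `linear_combination`.
* §2 `exists_pow_three_eq_Δ_of_nine_le_natCard_three_torsion` — **`9 ≤ #{P ∈ V(K) : 3P = O}` ⟹
  `Δ` is a cube in `K`** (`char K ∤ 6`): the `x`-coordinate of a non-zero `3`-torsion point is a root
  of `Ψ₃` (tree `eval_divisionPolynomial_three_eq_zero_of_three_smul_eq_zero`, Silverman Ex. 3.7),
  at most two points share an `x`-coordinate (`Affine.Y_eq_of_X_eq`), so `≥ 8` affine `3`-torsion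
  points force `4` distinct roots of the degree-`4` polynomial `Ψ₃` in `K`, whence the factorisation
  of §1 and `d = (c₄ - 9θ)/12`, `d³ = Δ`.
* §3 `natCard_three_torsion_le_three_of_forall_pow_three_ne` — **`Δ` not a cube ⟹ `#V(K)[3] ≤ 3`**
  (`K` with `char ∤ 6`, finitely many points): the `3`-torsion is a `3`-group (order `3ⁿ`), and
  `3ⁿ ≤ 8` forces `n ≤ 1`.
* §4 the RECORD currency `integralModelInt W = E₀` mod `ℓ` (`ℓ ≥ 5` prime): a `decide`-able
  hypothesis `∀ d : ZMod ℓ, d ^ 3 ≠ Δ(E₀ mod ℓ)` gives the binder `#Ẽ(𝔽_ℓ)[3] ≤ 3` in the consumers'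
  exact shape (`card_three_torsion_le_of_intModel_of_forall_pow_three_ne`) — a SECOND kernel road to
  the cyclicity flag, needing no externally searched witness; and the Euler/Fermat form
  (`forall_pow_three_ne_of_pow_div_three_ne_one`): for `3 ∣ ℓ - 1`, `Δ̄ ≠ 0` and
  `Δ̄^{(ℓ-1)/3} ≠ 1` imply that `Δ̄` is not a cube — r1's `O(log ℓ)` test I-CYC′ as a PROVEN
  sufficient condition for cyclicity.

HONEST LIMITS: the CONVERSE (on `𝒫₁(E, 3)`: cyclic ⟹ `Δ_E` not a cube mod `ℓ`, i.e. a unipotent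
Frobenius of order `3` acts as a `3`-cycle on the cube roots of `Δ` — the `Q₈ ◁ SL₂(𝔽₃)` argument)
is NOT proved here; C-DISC (the VALUE law of §39.2) is untouched EVIDENCE; no record, END or
certificate file is edited; nothing is booked; census −0.

References: J. H. Silverman, *The Arithmetic of Elliptic Curves*, 2nd ed. (2009), III.1 (`b_i`,
`c₄`, `Δ`, the relation `4b₈ = b₂b₆ - b₄²`), Exercise 3.7 (`ψ₃`) [SilvermanAEC2009]; J.-P. Serre,
*Propriétés galoisiennes des points d'ordre fini des courbes elliptiques*, Invent. Math. 15 (1972)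
§5.3 (`ℚ(E[3]) ⊇ ℚ(μ₃, ∛Δ)`, context only) [Serre1972]; C.-H. Kim, AJM 148 (2026) §1.2.2 (the cyclic
reduction condition on Kolyvagin primes) [Kim2022StructureSelmer]; cell files
cells/n1011/ROUTE-1.md §39.2 (d), §39.4 (R1-68), cells/n1011/skel/T-ICYC.md; the tree's
`Literature/NumberTheory/EllipticCurves/ThreeTorsionRadicalProofs.lean` (the radical formula, whose
resolvent sentence this file proves in Vieta form).
-/

noncomputable section

open WeierstrassCurve Polynomial

namespace Summit.BirchSwinnertonDyer.Rank1Residual.Additive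

/-! ### §1 The resolvent identity `(c₄ - 9(x₁ + x₂ - x₃ - x₄)²)³ = 1728 Δ` -/

section Resolvent

variable {K : Type*} [Field K] (V : WeierstrassCurve K)

/-- Comparing coefficients of two quartics written as `∑ C aₖ X^k`. [folklore] -/
theorem coeff_eq_of_quartic_eq {a₀ a₁ a₂ a₃ a₄ b₀ b₁ b₂ b₃ b₄ : K}
    (h : C a₄ * X ^ 4 + C a₃ * X ^ 3 + C a₂ * X ^ 2 + C a₁ * X + C a₀ =
      C b₄ * X ^ 4 + C b₃ * X ^ 3 + C b₂ * X ^ 2 + C b₁ * X + C b₀) :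
    a₃ = b₃ ∧ a₂ = b₂ ∧ a₁ = b₁ ∧ a₀ = b₀ := by
  have h3 := congrArg (fun p : K[X] => p.coeff 3) h
  have h2 := congrArg (fun p : K[X] => p.coeff 2) h
  have h1 := congrArg (fun p : K[X] => p.coeff 1) h
  have h0 := congrArg (fun p : K[X] => p.coeff 0) h
  simp only [coeff_add, coeff_C_mul, coeff_X_pow, coeff_C, coeff_X] at h3 h2 h1 h0
  norm_num at h3 h2 h1 h0
  exact ⟨h3, h2, h1, h0⟩

/-- `Ψ₃` in the normal form `∑ C aₖ X^k`: `Ψ₃ = C 3 X⁴ + C b₂ X³ + C (3b₄) X² + C (3b₆) X + C b₈`.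
[cite: SilvermanAEC2009, Exercise 3.7] -/
theorem Ψ₃_eq_sum_C_mul_X_pow :
    V.Ψ₃ = C 3 * X ^ 4 + C V.b₂ * X ^ 3 + C (3 * V.b₄) * X ^ 2 + C (3 * V.b₆) * X + C V.b₈ := by
  rw [WeierstrassCurve.Ψ₃, map_mul, map_mul, map_ofNat]

/-- **Vieta for a split `Ψ₃`.** If `Ψ₃ = 3 (X - x₁)(X - x₂)(X - x₃)(X - x₄)` over a field with
`3 ≠ 0`, then `b₂ = -3e₁`, `b₄ = e₂`, `b₆ = -e₃`, `b₈ = 3e₄` in the elementary symmetric functions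
`eₖ` of the roots. [cite: SilvermanAEC2009, Exercise 3.7] -/
theorem vieta_of_Ψ₃_eq_prod (h3 : (3 : K) ≠ 0) {x₁ x₂ x₃ x₄ : K}
    (hΨ : V.Ψ₃ = C 3 * ((X - C x₁) * (X - C x₂) * (X - C x₃) * (X - C x₄))) :
    V.b₂ = -3 * (x₁ + x₂ + x₃ + x₄) ∧
      V.b₄ = x₁ * x₂ + x₁ * x₃ + x₁ * x₄ + x₂ * x₃ + x₂ * x₄ + x₃ * x₄ ∧
      V.b₆ = -(x₁ * x₂ * x₃ + x₁ * x₂ * x₄ + x₁ * x₃ * x₄ + x₂ * x₃ * x₄) ∧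
      V.b₈ = 3 * (x₁ * x₂ * x₃ * x₄) := by
  have hexp : C 3 * ((X - C x₁) * (X - C x₂) * (X - C x₃) * (X - C x₄)) =
      C 3 * X ^ 4 + C (-3 * (x₁ + x₂ + x₃ + x₄)) * X ^ 3 +
        C (3 * (x₁ * x₂ + x₁ * x₃ + x₁ * x₄ + x₂ * x₃ + x₂ * x₄ + x₃ * x₄)) * X ^ 2 +
        C (3 * -(x₁ * x₂ * x₃ + x₁ * x₂ * x₄ + x₁ * x₃ * x₄ + x₂ * x₃ * x₄)) * X +
        C (3 * (x₁ * x₂ * x₃ * x₄)) := by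
    simp only [map_mul, map_add, map_neg]
    ring
  rw [Ψ₃_eq_sum_C_mul_X_pow, hexp] at hΨ
  obtain ⟨e3, e2, e1, e0⟩ := coeff_eq_of_quartic_eq hΨ
  refine ⟨e3, mul_left_cancel₀ h3 e2, mul_left_cancel₀ h3 (e1.trans (by ring)), e0⟩

/-- **The resolvent identity.** If the `3`-division polynomial splits as
`Ψ₃ = 3 (X - x₁)(X - x₂)(X - x₃)(X - x₄)` over a field with `3 ≠ 0`, then
`(c₄ - 9 (x₁ + x₂ - x₃ - x₄)²)³ = 1728 Δ` — the resolvent cubic of `Ψ₃/3` in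
`T = (x₁ + x₂ - x₃ - x₄)²` is `(T - c₄/9)³ = -64Δ/27` (classically `9T = c₄ - 12 ζ^i ∛Δ`).  Proof by
Vieta and Mathlib's `b_relation` (`4b₈ = b₂b₆ - b₄²`), one `linear_combination` (see the module
docstring for the polynomial identity used). [cite: SilvermanAEC2009, III.1 and Exercise 3.7] -/
theorem c₄_sub_nine_mul_sq_pow_three_eq (h3 : (3 : K) ≠ 0) {x₁ x₂ x₃ x₄ : K}
    (hΨ : V.Ψ₃ = C 3 * ((X - C x₁) * (X - C x₂) * (X - C x₃) * (X - C x₄))) :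
    (V.c₄ - 9 * (x₁ + x₂ - x₃ - x₄) ^ 2) ^ 3 = 1728 * V.Δ := by
  obtain ⟨hb2, hb4, hb6, hb8⟩ := vieta_of_Ψ₃_eq_prod V h3 hΨ
  have hrel := V.b_relation
  simp only [WeierstrassCurve.c₄, WeierstrassCurve.Δ]
  rw [hb2, hb4, hb6, hb8] at hrel ⊢
  linear_combination
    (15552 * ((x₁ * x₂ + x₁ * x₃ + x₁ * x₄ + x₂ * x₃ + x₂ * x₄ + x₃ * x₄) - (x₁ * x₂ + x₃ * x₄))) *
      hrel

/-- … hence, with `2` and `3` invertible, **`Δ` is a cube**: `d = (c₄ - 9 (x₁ + x₂ - x₃ - x₄)²)/12`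
has `d³ = Δ`. [cite: SilvermanAEC2009, III.1 and Exercise 3.7] -/
theorem exists_pow_three_eq_Δ_of_Ψ₃_eq_prod (h2 : (2 : K) ≠ 0) (h3 : (3 : K) ≠ 0)
    {x₁ x₂ x₃ x₄ : K}
    (hΨ : V.Ψ₃ = C 3 * ((X - C x₁) * (X - C x₂) * (X - C x₃) * (X - C x₄))) :
    ∃ d : K, d ^ 3 = V.Δ := by
  refine ⟨(V.c₄ - 9 * (x₁ + x₂ - x₃ - x₄) ^ 2) / 12, ?_⟩
  have h12 : (12 : K) ≠ 0 := by
    rw [show (12 : K) = 2 * 2 * 3 by norm_num]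
    exact mul_ne_zero (mul_ne_zero h2 h2) h3
  rw [div_pow, c₄_sub_nine_mul_sq_pow_three_eq V h3 hΨ]
  field_simp
  ring

end Resolvent

/-! ### §2 Nine rational `3`-torsion points split `Ψ₃` -/

section Points

variable {K : Type*} [Field K] (V : WeierstrassCurve K)

/-- The points of a Weierstrass curve over a finite field form a finite type (they inject into
`Option (K × K)`). [folklore] -/
theorem finite_point_of_finite [Finite K] : Finite V.toAffine.Point := by
  refine Finite.of_injective (fun P : V.toAffine.Point => match P with
    | .zero => (none : Option (K × K))
    | .some (x := x) (y := y) _ => some (x, y)) ?_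
  intro P Q h
  rcases P with _ | ⟨hP⟩ <;> rcases Q with _ | ⟨hQ⟩
  · rfl
  · simp at h
  · simp at h
  · simp only [Option.some.injEq, Prod.mk.injEq] at h
    obtain ⟨rfl, rfl⟩ := h
    rfl

open scoped Classical in
/-- **At most `1 + 2·#(roots of Ψ₃ in K)` points are killed by `3`.**  A non-zero point `P` with
`3P = O` is affine, `P = (x, y)` with `Ψ₃(x) = 0` (tree
`eval_divisionPolynomial_three_eq_zero_of_three_smul_eq_zero`, Silverman Ex. 3.7), and for each such
`x` there are at most two points `±P₀` (`Affine.Y_eq_of_X_eq`): the map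
`Option (roots × Bool) → {P : 3P = O}`, `none ↦ O`, `(x, ±) ↦ ±P₀(x)`, is onto.
[cite: SilvermanAEC2009, III.2.3 and Exercise 3.7] -/
theorem natCard_three_torsion_le_one_add_two_mul_card_roots [hdec : DecidableEq K]
    (h3 : (3 : K) ≠ 0) [Finite {P : V.toAffine.Point // 3 • P = 0}] :
    Nat.card {P : V.toAffine.Point // 3 • P = 0} ≤ 1 + 2 * V.Ψ₃.roots.toFinset.card := by
  -- align the `DecidableEq K` instance with the classical one of the tree lemmas (all are equal)
  obtain rfl : hdec = Classical.decEq K := Subsingleton.elim _ _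
  -- for each root `z`, is there an affine `3`-torsion point with abscissa `z`?
  let A : K → Prop := fun z => ∃ P : {P : V.toAffine.Point // 3 • P = 0},
    ∃ y, ∃ h : V.toAffine.Nonsingular z y, P.1 = Affine.Point.some z y h
  let g : Option (V.Ψ₃.roots.toFinset × Bool) → {P : V.toAffine.Point // 3 • P = 0} := fun o =>
    match o with
    | none => ⟨0, smul_zero _⟩
    | some (z, b) =>
      if hz : A z then (if b then hz.choose else ⟨-hz.choose.1, by
          rw [smul_neg, hz.choose.2, neg_zero]⟩)
      else ⟨0, smul_zero _⟩
  have hg : Function.Surjective g := by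
    rintro ⟨P, hP⟩
    rcases P with _ | ⟨x, y, h⟩
    · exact ⟨none, rfl⟩
    · -- `x` is a root of `Ψ₃`
      have hroot : x ∈ V.Ψ₃.roots.toFinset := by
        rw [Multiset.mem_toFinset, mem_roots (V.Ψ₃_ne_zero h3), IsRoot.def]
        exact eval_divisionPolynomial_three_eq_zero_of_three_smul_eq_zero (x := x) (y := y) (h := h)
          (by rw [natCast_zsmul]; exact hP)
      have hA : A x := ⟨⟨Affine.Point.some x y h, hP⟩, y, h, rfl⟩
      obtain ⟨y₀, h₀, hP₀⟩ := hA.choose_spec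
      -- `y = y₀` or `y = -y₀ - a₁ x - a₃`
      rcases Affine.Y_eq_of_X_eq h.left h₀.left rfl with hy | hy
      · refine ⟨some (⟨x, hroot⟩, true), ?_⟩
        simp only [g, dif_pos hA, if_true]
        exact Subtype.ext (by rw [hP₀]; subst hy; rfl)
      · refine ⟨some (⟨x, hroot⟩, false), ?_⟩
        simp only [g, dif_pos hA]
        refine Subtype.ext ?_
        change -hA.choose.1 = Affine.Point.some x y h
        rw [hP₀, Affine.Point.neg_some]
        subst hy
        rfl
  calc Nat.card {P : V.toAffine.Point // 3 • P = 0}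
      ≤ Nat.card (Option (V.Ψ₃.roots.toFinset × Bool)) := Nat.card_le_card_of_surjective g hg
    _ = 1 + 2 * V.Ψ₃.roots.toFinset.card := by
        rw [Nat.card_eq_fintype_card, Fintype.card_option, Fintype.card_prod, Fintype.card_bool,
          Fintype.card_coe]
        ring

/-- **Nine rational `3`-torsion points make `Δ` a cube** (over a field of characteristic `∤ 6`):
`9 ≤ #{P ∈ V(K) : 3P = O}` forces four distinct roots of the degree-`4` polynomial `Ψ₃` in `K`
(`natCard_three_torsion_le_one_add_two_mul_card_roots`), hence the factorisation
`Ψ₃ = 3 ∏ (X - xᵢ)` (Mathlib `C_leadingCoeff_mul_prod_multiset_X_sub_C`) and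
`d = (c₄ - 9 (x₁ + x₂ - x₃ - x₄)²)/12` with `d³ = Δ` (`exists_pow_three_eq_Δ_of_Ψ₃_eq_prod`).  This is
the elementary shadow of `K(E[3]) ⊇ K(μ₃, ∛Δ)` (Serre 1972, §5.3): if all of `E[3]` is rational, so
is `∛Δ`. [cite: SilvermanAEC2009, III.1 and Exercise 3.7] -/
theorem exists_pow_three_eq_Δ_of_nine_le_natCard_three_torsion [DecidableEq K]
    (h2 : (2 : K) ≠ 0) (h3 : (3 : K) ≠ 0) [Finite {P : V.toAffine.Point // 3 • P = 0}]
    (h9 : 9 ≤ Nat.card {P : V.toAffine.Point // 3 • P = 0}) : ∃ d : K, d ^ 3 = V.Δ := by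
  have hbound := natCard_three_torsion_le_one_add_two_mul_card_roots V h3
  have hZ4 : 4 ≤ V.Ψ₃.roots.toFinset.card := by omega
  have hdeg : V.Ψ₃.natDegree = 4 := V.natDegree_Ψ₃ h3
  have hcard_le : Multiset.card V.Ψ₃.roots ≤ 4 := hdeg ▸ card_roots' V.Ψ₃
  have htf : V.Ψ₃.roots.toFinset.card ≤ Multiset.card V.Ψ₃.roots := Multiset.toFinset_card_le _
  have hroots : Multiset.card V.Ψ₃.roots = 4 := le_antisymm hcard_le (hZ4.trans htf)
  obtain ⟨x₁, x₂, x₃, x₄, hs⟩ := Multiset.card_eq_four.mp hroots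
  have hlc : V.Ψ₃.leadingCoeff = 3 := by
    rw [Polynomial.leadingCoeff, hdeg, Ψ₃_eq_sum_C_mul_X_pow]
    simp only [coeff_add, coeff_C_mul, coeff_X_pow, coeff_C, coeff_X]
    norm_num
  have hfac := C_leadingCoeff_mul_prod_multiset_X_sub_C (p := V.Ψ₃) (by rw [hroots, hdeg])
  rw [hlc, hs] at hfac
  have hΨ : V.Ψ₃ = C 3 * ((X - C x₁) * (X - C x₂) * (X - C x₃) * (X - C x₄)) := by
    rw [← hfac]
    simp only [Multiset.insert_eq_cons, Multiset.map_cons, Multiset.map_singleton,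
      Multiset.prod_cons, Multiset.prod_singleton]
    ring
  exact exists_pow_three_eq_Δ_of_Ψ₃_eq_prod V h2 h3 hΨ

/-! ### §3 `Δ` not a cube ⟹ the rational `3`-torsion is cyclic -/

/-- **If `Δ` is not a cube in `K` then `#{P ∈ V(K) : 3P = O} ≤ 3`** (field of characteristic `∤ 6`,
finitely many `3`-torsion points): by `exists_pow_three_eq_Δ_of_nine_le_natCard_three_torsion` there
are at most `8` such points, and they form a `3`-group (`AddSubgroup.torsionBy`, order `3ⁿ`), so
`3ⁿ ≤ 8` gives `n ≤ 1`.  For `K = 𝔽_ℓ`, `ℓ ≥ 5`: **`Δ_E` not a cube mod `ℓ` ⟹ `Ẽ(𝔽_ℓ)[3]` is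
cyclic** — one direction of r1's I-CYC′ (ROUTE-1 §39.2 (d)), for EVERY such prime.
[cite: Kim2022StructureSelmer, §1.2.2 (the cyclic-reduction condition on Kolyvagin primes)]
[cite: SilvermanAEC2009, III.1 and Exercise 3.7] -/
theorem natCard_three_torsion_le_three_of_forall_pow_three_ne [DecidableEq K]
    (h2 : (2 : K) ≠ 0) (h3 : (3 : K) ≠ 0) [Finite {P : V.toAffine.Point // 3 • P = 0}]
    (hΔ : ∀ d : K, d ^ 3 ≠ V.Δ) :
    Nat.card {P : V.toAffine.Point // 3 • P = 0} ≤ 3 := by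
  have hlt : Nat.card {P : V.toAffine.Point // 3 • P = 0} < 9 := by
    by_contra h
    obtain ⟨d, hd⟩ :=
      exists_pow_three_eq_Δ_of_nine_le_natCard_three_torsion V h2 h3 (not_lt.mp h)
    exact hΔ d hd
  -- the `3`-torsion is a `3`-group
  set H : AddSubgroup V.toAffine.Point := AddSubgroup.torsionBy V.toAffine.Point 3 with hH
  have hmem : ∀ x : V.toAffine.Point, 3 • x = 0 ↔ x ∈ H := fun x =>
    AddSubgroup.torsionBy.nsmul_iff.symm
  have hcardH : Nat.card {x : V.toAffine.Point // 3 • x = 0} = Nat.card H :=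
    Nat.card_congr (Equiv.subtypeEquivRight hmem)
  haveI : Finite H := Finite.of_equiv _ (Equiv.subtypeEquivRight hmem)
  haveI : Fact (Nat.Prime 3) := ⟨Nat.prime_three⟩
  have hP : IsPGroup 3 (Multiplicative H) := by
    intro g
    refine ⟨1, ?_⟩
    apply Multiplicative.toAdd.injective
    rw [pow_one, toAdd_pow, toAdd_one]
    exact AddSubgroup.torsionBy.nsmul (Multiplicative.toAdd g)
  haveI : Finite (Multiplicative H) := Finite.of_equiv H Multiplicative.ofAdd
  obtain ⟨n, hn⟩ := IsPGroup.iff_card.mp hP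
  have hn' : Nat.card H = 3 ^ n := by rw [← hn]; exact Nat.card_congr Multiplicative.ofAdd
  rw [hcardH, hn'] at hlt ⊢
  have hn1 : n ≤ 1 := by
    by_contra h
    have h9 : 3 ^ 2 ≤ 3 ^ n := Nat.pow_le_pow_right (by norm_num) (by omega)
    omega
  calc 3 ^ n ≤ 3 ^ 1 := Nat.pow_le_pow_right (by norm_num) hn1
    _ = 3 := pow_one 3

end Points

/-! ### §4 The record currency: `integralModelInt W = E₀` reduced mod `ℓ` -/

section IntModel

/-- **The cyclicity binder at `p = 3` READ OFF AN INTEGER MODEL from "`Δ` is not a cube mod `ℓ`"**: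
`integralModelInt W = E₀`, a prime `ℓ ≥ 5`, and the DECIDABLE hypothesis
`∀ d : ZMod ℓ, d ^ 3 ≠ Δ(E₀ mod ℓ)` give `#Ẽ(𝔽_ℓ)[3] ≤ 3` in the exact shape of the cell's Kurihara
consumers (`X4.KuriharaUnitAt`, `KuriharaIndexLeAt`, the record ENDs' `hcyc`) — a second kernel road
next to `card_three_torsion_le_of_intModel_of_psi3_root` (no externally searched root witness).  If
`ℓ ∣ Δ` the hypothesis fails (`d = 0`), so no good-reduction binder is needed.  (The hypothesis is
stated before the `Fact ℓ.Prime` binder so that a record's instance is a closed `decide` goal.)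
[cite: Kim2022StructureSelmer, §1.2.2 and Thm. 1.10 (1)] [cite: SilvermanAEC2009, III.1 and Exercise 3.7] -/
theorem card_three_torsion_le_of_intModel_of_forall_pow_three_ne {W : WeierstrassCurve ℚ}
    [W.IsGloballyMinimal] {E₀ : WeierstrassCurve ℤ} (hI : integralModelInt W = E₀) (ℓ : ℕ)
    (hΔ : ∀ d : ZMod ℓ, d ^ 3 ≠ (E₀.map (Int.castRingHom (ZMod ℓ))).Δ) [hℓ : Fact ℓ.Prime]
    (h5 : 5 ≤ ℓ) :
    Nat.card {P : ((WeierstrassCurve.integralModelInt W).map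
        (Int.castRingHom (ZMod ℓ))).toAffine.Point // 3 • P = 0} ≤ 3 := by
  subst hI
  set V : WeierstrassCurve (ZMod ℓ) :=
    (WeierstrassCurve.integralModelInt W).map (Int.castRingHom (ZMod ℓ)) with hV
  haveI : Finite V.toAffine.Point := finite_point_of_finite V
  haveI : Finite {P : V.toAffine.Point // 3 • P = 0} := Subtype.finite
  have h2 : (2 : ZMod ℓ) ≠ 0 := by
    intro h
    have hdvd : ℓ ∣ 2 := (ZMod.natCast_eq_zero_iff 2 ℓ).mp (by exact_mod_cast h)
    have := Nat.le_of_dvd two_pos hdvd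
    omega
  have h3 : (3 : ZMod ℓ) ≠ 0 := by
    intro h
    have hdvd : ℓ ∣ 3 := (ZMod.natCast_eq_zero_iff 3 ℓ).mp (by exact_mod_cast h)
    have := Nat.le_of_dvd three_pos hdvd
    omega
  exact natCard_three_torsion_le_three_of_forall_pow_three_ne V h2 h3 hΔ

/-- **Euler's criterion form (r1's `O(log ℓ)` test I-CYC′ as a proven sufficient condition).** For a
prime `ℓ` with `3 ∣ ℓ - 1` and `a ∈ 𝔽_ℓ` with `a ≠ 0` and `a^{(ℓ-1)/3} ≠ 1`, `a` is not a cube: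
`d³ = a ≠ 0` would give `a^{(ℓ-1)/3} = d^{ℓ-1} = 1` (Fermat).  With `a = Δ(E₀ mod ℓ)` this feeds
`card_three_torsion_le_of_intModel_of_forall_pow_three_ne`. [folklore] -/
theorem forall_pow_three_ne_of_pow_div_three_ne_one {ℓ : ℕ} [Fact ℓ.Prime] (h3 : 3 ∣ ℓ - 1)
    {a : ZMod ℓ} (ha : a ≠ 0) (h : a ^ ((ℓ - 1) / 3) ≠ 1) : ∀ d : ZMod ℓ, d ^ 3 ≠ a := by
  intro d hd
  apply h
  have hd0 : d ≠ 0 := by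
    rintro rfl
    exact ha (by rw [← hd]; ring)
  rw [← hd, ← pow_mul, Nat.mul_div_cancel' h3]
  exact ZMod.pow_card_sub_one_eq_one hd0

/-- The two together, in the records' shape: `ℓ ≥ 5` prime with `3 ∣ ℓ - 1`, `Δ(E₀ mod ℓ) ≠ 0` and
`Δ(E₀ mod ℓ)^{(ℓ-1)/3} ≠ 1` ⟹ `#Ẽ(𝔽_ℓ)[3] ≤ 3` — each hypothesis a closed `decide` / `norm_num` goal
on a literal model. [cite: Kim2022StructureSelmer, §1.2.2 and Thm. 1.10 (1)] -/
theorem card_three_torsion_le_of_intModel_of_pow_div_three_ne_one {W : WeierstrassCurve ℚ}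
    [W.IsGloballyMinimal] {E₀ : WeierstrassCurve ℤ} (hI : integralModelInt W = E₀) (ℓ : ℕ)
    (hΔ0 : (E₀.map (Int.castRingHom (ZMod ℓ))).Δ ≠ 0)
    (hχ : (E₀.map (Int.castRingHom (ZMod ℓ))).Δ ^ ((ℓ - 1) / 3) ≠ 1) [Fact ℓ.Prime]
    (h5 : 5 ≤ ℓ) (h31 : 3 ∣ ℓ - 1) :
    Nat.card {P : ((WeierstrassCurve.integralModelInt W).map
        (Int.castRingHom (ZMod ℓ))).toAffine.Point // 3 • P = 0} ≤ 3 :=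
  card_three_torsion_le_of_intModel_of_forall_pow_three_ne hI ℓ
    (forall_pow_three_ne_of_pow_div_three_ne_one h31 hΔ0 hχ) h5

end IntModel

/-! ### §5 Self-tests on a record curve (`17640ce1`, the END-m2 pilot; cf.
`X4ThreeKolyvaginLevelTwoCertificates1.forall_card_torsion_le_v17640ce1_n255421`, certified there by a
root of `Ψ₃`; here by the cube test — r1's I-CYC′ reading `Δ^{(ℓ-1)/3} ≢ 1` at `ℓ = 163`) -/

section SelfTest

/-- `17640ce1` (`E₀ = [0, 0, 0, -1242003, -532681058]`) at the Kolyvagin prime `ℓ = 163`: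
`Δ ≡ 92 (mod 163)` is not a cube (`92^54 ≡ 58 ≢ 1`), so `#Ẽ(𝔽₁₆₃)[3] ≤ 3` — the cyclicity binder at
the prime `163` of the END-m2 pilot level `163 · 1567`, by the Euler form (stated with a bound prime
`ℓ = 163` so that `Fact ℓ.Prime` is a binder, as in the record files). [folklore] -/
theorem card_three_torsion_le_v17640ce1_163 {W : WeierstrassCurve ℚ} [W.IsGloballyMinimal]
    (hI : integralModelInt W = ⟨0, 0, 0, -1242003, -532681058⟩) (ℓ : ℕ) [Fact ℓ.Prime]
    (hℓ : ℓ = 163) :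
    Nat.card {P : ((WeierstrassCurve.integralModelInt W).map
        (Int.castRingHom (ZMod ℓ))).toAffine.Point // 3 • P = 0} ≤ 3 := by
  subst hℓ
  exact card_three_torsion_le_of_intModel_of_pow_div_three_ne_one hI 163 (by decide +kernel)
    (by decide +kernel) (by norm_num) (by norm_num)

end SelfTest


end Summit.BirchSwinnertonDyer.Rank1Residual.Additive

end
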